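import Summits.ResolutionOfSingularities.ResolutionOfSingularities.Theorems.MarkedIdealsSolidCentre
import Literature.AlgebraicGeometry.Resolution.ColonIdealSheafFG
import Literature.AlgebraicGeometry.Resolution.EffectiveCartierStalks
import Literature.AlgebraicGeometry.Resolution.BlowupOffCentre
import HarnessLib

/-!
# Blowing up the solid part of a marked ideal: the F-solid move decided

Topic: `Literature/AlgebraicGeometry/Resolution` (TOOL, decomp-res lens-6 g30; continuation of
`Theorems/MarkedIdealsSolidCentre.lean`, namespace `Literature.AlgebraicGeometry.Resolution.MarkedIdeal`). For a marked
ideal `(𝓘, n)` with `1 ≤ n`, `ord 𝓘 ≤ n` everywhere, closed support, on a locally Noetherian regular scheme `X` with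
Noetherian underlying space, and a blow-up `τ : X′ → X` of the ideal `𝓘(solid)` of the solid part:

* `MarkedIdeal.ideal_le_vanishingIdeal_solidPart_pow` — `𝓘 ⊆ 𝓘(solid)^n`;
* `MarkedIdeal.isEffectiveCartier_vanishingIdeal_solidPart` — `𝓘(solid)` is an effective Cartier divisor, so
  `MarkedIdeal.isIso_of_isBlowup_vanishingIdeal_solidPart` — `τ` is an isomorphism (Görtz–Wedhorn I, after Def. 13.90);
* `MarkedIdeal.stalkIdeal_transform_eq_top_of_mem_solidPart` — over a solid point the controlled transform
  `τᶜ(𝓘, n)` is the unit ideal (`τ^*𝓘 = 𝓘_E^n · τᶜ(𝓘, n)`, BGMW Lemma 3.2.1 (2), and `(τ^*𝓘)_{x′} = 𝓘_{E,x′}^n` is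
  generated by a non-zero-divisor);
* **`MarkedIdeal.coe_support_transform_vanishingIdeal_solidPart`** — `supp (τᶜ(𝓘, n), n) = τ⁻¹(rest part)` exactly;
* `MarkedIdeal.topologicalKrullDim_support_transform_vanishingIdeal_solidPart_le` — the new support has dimension
  `≤ dim X − 2`; `MarkedIdeal.isClosed_support_transform_vanishingIdeal_solidPart`;
  `MarkedIdeal.two_le_coheight_base_of_mem_support_transform`.

First consumer: the F-solid letter of the g31 «SurfCut» frame of `E1TopGHeavy` (after it, the Cossart–Jannsen–Saito
surface phase runs on a closed set of dimension `≤ 2`).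

References: E. Bierstone, D. Grigoriev, P. Milman, J. Włodarczyk, arXiv:1206.3090, §3.2 Lemma 3.2.1;
U. Görtz, T. Wedhorn, Algebraic Geometry I (2nd ed. 2020), Def. 13.90 ff., Prop. 13.91; The Stacks Project, Tags 01WS,
0809, 02OS. [new; elementary] [folklore]
-/

noncomputable section

open CategoryTheory CategoryTheory.Limits AlgebraicGeometry TopologicalSpace Topology Order IsLocalRing

namespace Literature.AlgebraicGeometry.Resolution

universe u

open Scheme.IdealSheafData

section SolidCentreTransform

/-! #### §SolidCentreTransform — THE F-solid MOVE DECIDED: `𝓘 ⊆ 𝓘(solid)^n`; the ideal of the solid part is an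
EFFECTIVE CARTIER DIVISOR (so its blow-up `τ` is an isomorphism); over a solid point the controlled transform is the
unit ideal, off the solid part it has the old order; hence the support of the transformed marked ideal is EXACTLY the
preimage of the rest part, of dimension `≤ dim X − 2`. -/

variable {X : Scheme.{u}}

namespace MarkedIdeal

variable {M : MarkedIdeal X}

/-- **`𝓘 ⊆ 𝓘(solid)^n`**: at a solid point `𝓘_x = 𝔭_ζ^n = 𝓘(solid)_x^n`, elsewhere `𝓘(solid)_x = (1)`. [new] [folklore] -/
theorem ideal_le_vanishingIdeal_solidPart_pow [NoetherianSpace X] (hX : Scheme.IsRegular X) (hn1 : 1 ≤ M.mult)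
    (hord : ∀ y : X, idealOrder M.ideal y ≤ (M.mult : ℕ∞)) (hS : IsClosed M.support) :
    M.ideal ≤ vanishingIdeal ⟨M.solidPart, isClosed_solidPart hX hn1 hord hS⟩ ^ M.mult := by
  refine le_of_forall_stalkIdeal_le fun x => ?_
  rw [stalkIdeal_pow]
  by_cases hx : x ∈ M.solidPart
  · obtain ⟨-, ζ, hζS, hζ, h⟩ := hx
    rw [stalkIdeal_eq_stalkIdeal_vanishingIdeal_solidPart_pow hX hn1 hord hS hζ hζS h]
  · have hx' : x ∉ ((vanishingIdeal ⟨M.solidPart, isClosed_solidPart hX hn1 hord hS⟩).support : Set X) := by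
      rwa [coe_support_vanishingIdeal_solidPart hX hn1 hord hS]
    rw [stalkIdeal_eq_top_of_not_mem_support hx', Ideal.top_pow]
    exact le_top

/-- **THE IDEAL OF THE SOLID PART IS AN EFFECTIVE CARTIER DIVISOR**: at a solid point its stalk is `(p)` with `p` a
prime element of the (regular, hence integral) local ring. [new] [folklore] -/
theorem isEffectiveCartier_vanishingIdeal_solidPart [IsLocallyNoetherian X] [NoetherianSpace X]
    (hX : Scheme.IsRegular X) (hn1 : 1 ≤ M.mult) (hord : ∀ y : X, idealOrder M.ideal y ≤ (M.mult : ℕ∞))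
    (hS : IsClosed M.support) :
    IsEffectiveCartier (vanishingIdeal ⟨M.solidPart, isClosed_solidPart hX hn1 hord hS⟩) := by
  refine isEffectiveCartier_of_forall_mem_nonZeroDivisors fun x hx => ?_
  have hx' : x ∈ M.solidPart := by
    rw [← coe_support_vanishingIdeal_solidPart hX hn1 hord hS]; exact hx
  obtain ⟨-, ζ, hζS, hζ, h⟩ := hx'
  obtain ⟨p, hp, hpeq, -, -⟩ := exists_generator_of_mem_support_of_coheight_eq_one hX M hn1 hord hζ hζS h
  haveI := hX x
  haveI : IsDomain (X.presheaf.stalk x) := isDomain_of_isRegularLocalRing _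
  exact ⟨p, mem_nonZeroDivisors_of_ne_zero hp.ne_zero,
    by rw [stalkIdeal_vanishingIdeal_solidPart hX hn1 hord hS hζ hζS h, hpeq]⟩

/-- **BLOWING UP THE SOLID PART IS AN ISOMORPHISM** (the centre is an effective Cartier divisor; Görtz–Wedhorn I,
remark after Def. 13.90). [new] [folklore] -/
theorem isIso_of_isBlowup_vanishingIdeal_solidPart [IsLocallyNoetherian X] [NoetherianSpace X]
    (hX : Scheme.IsRegular X) (hn1 : 1 ≤ M.mult) (hord : ∀ y : X, idealOrder M.ideal y ≤ (M.mult : ℕ∞))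
    (hS : IsClosed M.support) {X' : Scheme.{u}} {τ : X' ⟶ X}
    (hτ : IsBlowup τ (vanishingIdeal ⟨M.solidPart, isClosed_solidPart hX hn1 hord hS⟩)) : IsIso τ :=
  hτ.isIso (isEffectiveCartier_vanishingIdeal_solidPart hX hn1 hord hS)

/-- **OVER A SOLID POINT THE CONTROLLED TRANSFORM IS THE UNIT IDEAL**: `τ^*𝓘 = 𝓘_E^n · 𝓘'` (BGMW Lemma 3.2.1 (2)),
`(τ^*𝓘)_{x'} = 𝓘_{E,x'}^n = (g^n)` with `g` a non-zero-divisor, so `(g^n) · 𝓘'_{x'} = (g^n)` forces `𝓘'_{x'} = (1)`.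
[new] [folklore] -/
theorem stalkIdeal_transform_eq_top_of_mem_solidPart [IsLocallyNoetherian X] [NoetherianSpace X]
    (hX : Scheme.IsRegular X) (hn1 : 1 ≤ M.mult) (hord : ∀ y : X, idealOrder M.ideal y ≤ (M.mult : ℕ∞))
    (hS : IsClosed M.support) {X' : Scheme.{u}} {τ : X' ⟶ X}
    (hτ : IsBlowup τ (vanishingIdeal ⟨M.solidPart, isClosed_solidPart hX hn1 hord hS⟩)) {x' : X'}
    (hx : τ x' ∈ M.solidPart) :
    stalkIdeal (M.transform τ (vanishingIdeal ⟨M.solidPart, isClosed_solidPart hX hn1 hord hS⟩)).ideal x' = ⊤ := by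
  obtain ⟨-, ζ, hζS, hζ, h⟩ := hx
  have hfac := hτ.pow_mul_controlledTransform_eq
    (comap_le_comap_pow_of_le_pow (ideal_le_vanishingIdeal_solidPart_pow hX hn1 hord hS) τ)
  have hst := congrArg (fun I => stalkIdeal I x') hfac
  simp only [stalkIdeal_mul, stalkIdeal_pow] at hst
  obtain ⟨g, hg, hgeq⟩ := hτ.isEffectiveCartier.mem_cartierLocus x'
  have hIC : stalkIdeal (M.ideal.comap τ) x' =
      stalkIdeal ((vanishingIdeal ⟨M.solidPart, isClosed_solidPart hX hn1 hord hS⟩).comap τ) x' ^ M.mult := by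
    rw [stalkIdeal_comap_eq_map_stalkMap, stalkIdeal_comap_eq_map_stalkMap,
      stalkIdeal_eq_stalkIdeal_vanishingIdeal_solidPart_pow hX hn1 hord hS hζ hζS h, Ideal.map_pow]
  rw [hIC, hgeq, Ideal.span_singleton_pow] at hst
  rw [transform_ideal, Ideal.eq_top_iff_one]
  have hmem : g ^ M.mult ∈ Ideal.span {g ^ M.mult} *
      stalkIdeal (controlledTransform τ (vanishingIdeal ⟨M.solidPart, isClosed_solidPart hX hn1 hord hS⟩) M.ideal
        M.mult) x' := by
    rw [hst]; exact Ideal.mem_span_singleton_self _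
  obtain ⟨z, hz, hgz⟩ := Ideal.mem_span_singleton_mul.mp hmem
  have hz1 : z = 1 := (mul_cancel_left_mem_nonZeroDivisors (pow_mem hg M.mult)).mp (by rw [hgz, mul_one])
  exact hz1 ▸ hz

/-- **THE SUPPORT AFTER THE F-solid MOVE IS THE PREIMAGE OF THE REST PART**: over a solid point the transform is the
unit ideal (order `0 < n`); off the solid part the order is unchanged (`IsBlowup.idealOrder_controlledTransform_of_not_mem`)
and `supp = solid ∪ rest`. [new] [folklore] -/
theorem coe_support_transform_vanishingIdeal_solidPart [IsLocallyNoetherian X] [NoetherianSpace X]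
    (hX : Scheme.IsRegular X) (hn1 : 1 ≤ M.mult) (hord : ∀ y : X, idealOrder M.ideal y ≤ (M.mult : ℕ∞))
    (hS : IsClosed M.support) {X' : Scheme.{u}} {τ : X' ⟶ X}
    (hτ : IsBlowup τ (vanishingIdeal ⟨M.solidPart, isClosed_solidPart hX hn1 hord hS⟩)) :
    (M.transform τ (vanishingIdeal ⟨M.solidPart, isClosed_solidPart hX hn1 hord hS⟩)).support = τ.base ⁻¹' M.restPart := by
  ext x'
  simp only [Set.mem_preimage]
  by_cases hx : τ x' ∈ M.solidPart
  · have hrest : τ x' ∉ M.restPart := fun h' => Set.disjoint_left.mp (disjoint_solidPart_restPart M) hx h'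
    simp only [hrest, iff_false]
    intro hmem
    rw [mem_support_iff, stalkIdeal_transform_eq_top_of_mem_solidPart hX hn1 hord hS hτ hx, transform_mult, top_le_iff]
      at hmem
    have hne : M.mult ≠ 0 := by omega
    exact (maximalIdeal.isMaximal (X'.presheaf.stalk x')).ne_top
      (top_le_iff.mp (hmem.symm.le.trans (Ideal.pow_le_self hne)))
  · have hnot : τ x' ∉ ((vanishingIdeal ⟨M.solidPart, isClosed_solidPart hX hn1 hord hS⟩).support : Set X) := by
      rwa [coe_support_vanishingIdeal_solidPart hX hn1 hord hS]
    have key : x' ∈ (M.transform τ (vanishingIdeal ⟨M.solidPart, isClosed_solidPart hX hn1 hord hS⟩)).support ↔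
        τ x' ∈ M.support := by
      simp only [MarkedIdeal.support, Set.mem_setOf_eq, transform_mult, transform_ideal,
        hτ.idealOrder_controlledTransform_of_not_mem _ _ hnot]
    rw [key, ← solidPart_union_restPart M, Set.mem_union]
    exact ⟨fun h' => h'.resolve_left hx, Or.inr⟩

/-- **THE DIMENSION GUARD AFTER THE F-solid MOVE**: the new support is the (homeomorphic) preimage of the rest part,
of dimension `≤ dim X − 2`. [new] [folklore] -/
theorem topologicalKrullDim_support_transform_vanishingIdeal_solidPart_le [IsLocallyNoetherian X] [NoetherianSpace X]
    (hX : Scheme.IsRegular X) (hn1 : 1 ≤ M.mult) (hord : ∀ y : X, idealOrder M.ideal y ≤ (M.mult : ℕ∞))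
    (hS : IsClosed M.support) {d : ℕ} (hd : topologicalKrullDim X ≤ d) {X' : Scheme.{u}} {τ : X' ⟶ X}
    (hτ : IsBlowup τ (vanishingIdeal ⟨M.solidPart, isClosed_solidPart hX hn1 hord hS⟩)) :
    topologicalKrullDim (M.transform τ (vanishingIdeal ⟨M.solidPart, isClosed_solidPart hX hn1 hord hS⟩)).support ≤
      ((d - 2 : ℕ) : WithBot ℕ∞) := by
  rw [coe_support_transform_vanishingIdeal_solidPart hX hn1 hord hS hτ]
  haveI := isIso_of_isBlowup_vanishingIdeal_solidPart hX hn1 hord hS hτ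
  exact (τ.isOpenEmbedding.isInducing.restrictPreimage M.restPart).topologicalKrullDim_le.trans
    (topologicalKrullDim_restPart_le hX hn1 hord hS hd)

/-- **THE NEW SUPPORT IS CLOSED** (preimage of the closed rest part). [new] [folklore] -/
theorem isClosed_support_transform_vanishingIdeal_solidPart [IsLocallyNoetherian X] [NoetherianSpace X]
    (hX : Scheme.IsRegular X) (hn1 : 1 ≤ M.mult) (hord : ∀ y : X, idealOrder M.ideal y ≤ (M.mult : ℕ∞))
    (hS : IsClosed M.support) {X' : Scheme.{u}} {τ : X' ⟶ X}
    (hτ : IsBlowup τ (vanishingIdeal ⟨M.solidPart, isClosed_solidPart hX hn1 hord hS⟩)) :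
    IsClosed (M.transform τ (vanishingIdeal ⟨M.solidPart, isClosed_solidPart hX hn1 hord hS⟩)).support := by
  rw [coe_support_transform_vanishingIdeal_solidPart hX hn1 hord hS hτ]
  exact (isClosed_restPart hX hn1 hord hS).preimage τ.base.hom.continuous

/-- **NO SOLID POINTS UPSTAIRS MAP TO SOLID POINTS**: every support point of the transform lies over the rest part, so
over a point of coheight `≥ 2`. [new] [folklore] -/
theorem two_le_coheight_base_of_mem_support_transform [IsLocallyNoetherian X] [NoetherianSpace X]
    (hX : Scheme.IsRegular X) (hn1 : 1 ≤ M.mult) (hord : ∀ y : X, idealOrder M.ideal y ≤ (M.mult : ℕ∞))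
    (hS : IsClosed M.support) {X' : Scheme.{u}} {τ : X' ⟶ X}
    (hτ : IsBlowup τ (vanishingIdeal ⟨M.solidPart, isClosed_solidPart hX hn1 hord hS⟩)) {x' : X'}
    (hx : x' ∈ (M.transform τ (vanishingIdeal ⟨M.solidPart, isClosed_solidPart hX hn1 hord hS⟩)).support) :
    2 ≤ Order.coheight (τ x') := by
  rw [coe_support_transform_vanishingIdeal_solidPart hX hn1 hord hS hτ] at hx
  exact two_le_coheight_of_mem_restPart hX hn1 hord hx

end MarkedIdeal

end SolidCentreTransform

end Literature.AlgebraicGeometry.Resolution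

end
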